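import Summits.QuantumFields.YangMills.Theorems.SwapVirialDeficitBlowUpGnomonicBaseLetterSpeeds
import HarnessLib

/-!
# THE SECOND SEAM-COMMUTATOR STIFFNESS FLOOR `[C₁, C₂]` AT THE GNOMONIC BASE POINTS: `Q(w) ≥ ‖W′·ŷ₀ + x̂₀·Y′ − Y′·x̂₀ − ŷ₀·W′‖²/(900·L⁶)`
# (free-hands support of ⟨stmt-QuantumFields-24197⟩ `SwapVirialDeficit.SwapGluedStiffness`; stub S3∕S4 «finiteness of the bottom measure», END region — companion of
# ✓`fibre_raySecond_ge_seamComm`)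

With `W′ = Ā·X′·A + x̂₀·Z′` the speed of the slaved letter `ŵ = Ā·x̂·A·ẑ` (✓`hasDerivAt_slaved_ray`) and `Y′ = (√(1+y₀²))⁻¹·(±(0,0,v))` the speed of `ŷ`, the commutator path
`g(s) = ŵ(s)ŷ(s) − ŷ(s)ŵ(s)` vanishes at the flat base point (`ŵ(0) = x̂₀` and `ŷ₀` are axial) and `g′(0) = W′ŷ₀ + x̂₀Y′ − Y′x̂₀ − ŷ₀W′`; the global floor
✓`chartDeficit_ge_of_comm_far` (`μ = 1, ν = 2`) then gives, exactly as in the `[C₀,C₁]` file,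
* ★★★ `fibre_raySecond_ge_seamComm₂`: `‖W′·ŷ₀ + x̂₀·Y′ − Y′·x̂₀ − ŷ₀·W′‖²/(900·L⁶) ≤ (d²/ds²)F̂(η₀ + s·ξ(w))|₀`.
At the END `ψ = π/2` (`Ad_A` = the π-rotation on `(j,k)`) the `(j,k)`-part of `W′` is `−(0,0,u)/√(1+x₀²)·(±)` rotated, so this floor carries `|y₀·Ru − x₀·v|²`
with `R` the `2ψ`-rotation — together with ✓`gnoDeficit_one_ge_relRot` (`|y₀u − x₀v|²`) it pins `u` by `y₀²` and `v` by `x₀²` at the end, and with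
✓`fibre_raySecond_ge_seamComm` (`x₀²sin²ψ|u|²`) the soft determinant near stratum B is `≍ (δψ² + x₀² + y₀²)`-controlled — integrable (LEAD memo4 §2).

HONEST LABEL: composition of landed inequalities + one-variable calculus; S3∕S4∕S5, ⟨24197⟩ ∕ ⟨24194⟩ ∕ ⟨24497⟩ OPEN; own crux ⟨22884⟩ OPEN (blocked-on ⟨19935⟩); the
Yang–Mills mass gap is NOT proved; no summit is proved by a line.  THEOREMS ONLY (0 `def`, 0 `sorry`), standard axioms.
Width seat ym-line-sfw-p2-w3 g66 (cell ym-idea-1, free hands), `--supports stmt-QuantumFields-24197`.  References: [cite: Luscher1983, §2]; [folklore].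
-/

set_option autoImplicit false

noncomputable section

open MeasureTheory Quaternion
open scoped BigOperators Quaternion RealInnerProductSpace ContDiff
open Literature.MathematicalPhysics.QuantumFieldTheory hiding SU2
open Literature.MathematicalPhysics.QuantumLattice
open Literature.Analysis.Calculus (radialUnit radialUnit_def norm_radialUnit)

namespace Summit.QuantumFields.YangMills.Theorems.SwapVirialDeficit.BlowUpRing

open Summit.QuantumFields.YangMills.Theorems.FemtoTransferGap
open Summit.QuantumFields.YangMills.Theorems.FemtoTransferGap.TT
open Summit.QuantumFields.YangMills.Theorems.FemtoTransferGap.TwoLattice.Flat (fd)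
open Summit.QuantumFields.YangMills.Theorems.VirialFluxGap.RingDeficit
open Summit.QuantumFields.YangMills.Theorems.SwapVirialDeficit.SwapRing
open Summit.QuantumFields.YangMills.Theorems.SwapTwistDeficit.ToronLog (axisPoint norm_comm_sq)
open Summit.QuantumFields.YangMills.Theorems.SwapVirialDeficit.ZeroModeSigma (norm_axisUnit su2Quat_quatToSU2_eq_radialUnit axisUnit_axial axial_comm)
open Summit.QuantumFields.YangMills.Theorems.SwapVirialDeficit.Gnomonic (contDiff_gnoDeficit contDiff_radialUnit_gnoLetter)
open Summit.QuantumFields.YangMills.Theorems.QuantitativeLaplace (iteratedDeriv_two_ge_of_minorant)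
open Summit.QuantumFields.YangMills.Theorems.ToronValleyVolume.Lojasiewicz (fd_sq_eq_two_mul)

variable {L : ℕ} [NeZero L]

/-! ## The `[C₁, C₂]` ray minorant and its second derivative -/

/-- ★★★ **THE `[C₁, C₂]` FLOOR** (principal sector; hub `a ≠ 0`, signs `ε_z = +`, followers `+`): for every fibre direction `w`,
`‖W′·ŷ₀ + x̂₀·Y′ − Y′·x̂₀ − ŷ₀·W′‖²/(900·L⁶) ≤ (d²/ds²) F̂(η₀ + s·ξ(w))|₀` with `x̂₀ = ν(gnoLetter ε_x (x₀,0,0))`, `ŷ₀ = ν(gnoLetter ε_y (y₀,0,0))`, `A = ν(axisPoint a)`,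
`X′ = (√(1+x₀²))⁻¹·(gnoSign ε_x·(0,0,u))`, `Y′ = (√(1+y₀²))⁻¹·(gnoSign ε_y·(0,0,v))`, `Z′ = (0, z)`, `W′ = Ā·X′·A + x̂₀·Z′`. [cite: Luscher1983, §2] -/
theorem fibre_raySecond_ge_seamComm₂ {a : ℍ} (ha : a ≠ 0) (ε : GnoSign L) (hz : ε.2.1 = true) (hε : ε.2.2 = fun _ => true) (x₀ y₀ : ℝ)
    (w : ((Fin 2 → ℝ) × (Fin 2 → ℝ)) × (Fin 3 → ℝ) × (Fol L → Fin 3 → ℝ)) :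
    ‖(star (radialUnit (axisPoint a)) * ((Real.sqrt (1 + x₀ ^ 2))⁻¹ • (gnoSign ε.1.1 • (gnomonicQuat ![0, w.1.1 0, w.1.1 1]).im)) * radialUnit (axisPoint a) +
            radialUnit (gnoLetter ε.1.1 ![x₀, 0, 0]) * (gnomonicQuat w.2.1).im) * radialUnit (gnoLetter ε.1.2 ![y₀, 0, 0]) +
          radialUnit (gnoLetter ε.1.1 ![x₀, 0, 0]) * ((Real.sqrt (1 + y₀ ^ 2))⁻¹ • (gnoSign ε.1.2 • (gnomonicQuat ![0, w.1.2 0, w.1.2 1]).im)) -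
          (Real.sqrt (1 + y₀ ^ 2))⁻¹ • (gnoSign ε.1.2 • (gnomonicQuat ![0, w.1.2 0, w.1.2 1]).im) * radialUnit (gnoLetter ε.1.1 ![x₀, 0, 0]) -
          radialUnit (gnoLetter ε.1.2 ![y₀, 0, 0]) *
            (star (radialUnit (axisPoint a)) * ((Real.sqrt (1 + x₀ ^ 2))⁻¹ • (gnoSign ε.1.1 • (gnomonicQuat ![0, w.1.1 0, w.1.1 1]).im)) * radialUnit (axisPoint a) +
              radialUnit (gnoLetter ε.1.1 ![x₀, 0, 0]) * (gnomonicQuat w.2.1).im)‖ ^ 2 / (900 * (L : ℝ) ^ 6) ≤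
      iteratedDeriv 2 (fun s : ℝ => gnoDeficit (fun _ => false) (fun _ => 1) a ε
        (((((![x₀, 0, 0] : Fin 3 → ℝ), (![y₀, 0, 0] : Fin 3 → ℝ)), ((0 : Fin 3 → ℝ), (0 : Fol L → Fin 3 → ℝ))) : GnoCoord L) +
          s • ((((![0, w.1.1 0, w.1.1 1] : Fin 3 → ℝ), (![0, w.1.2 0, w.1.2 1] : Fin 3 → ℝ)), (w.2.1, w.2.2)) : GnoCoord L))) 0 := by
  have hL : (0 : ℝ) < L := by exact_mod_cast NeZero.pos L
  -- names
  set A : ℍ := radialUnit (axisPoint a) with hA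
  set X' : ℍ := (Real.sqrt (1 + x₀ ^ 2))⁻¹ • (gnoSign ε.1.1 • (gnomonicQuat ![0, w.1.1 0, w.1.1 1]).im) with hX'
  set Z' : ℍ := (gnomonicQuat w.2.1).im with hZ'
  set Y' : ℍ := (Real.sqrt (1 + y₀ ^ 2))⁻¹ • (gnoSign ε.1.2 • (gnomonicQuat ![0, w.1.2 0, w.1.2 1]).im) with hY'
  set η : ℝ → GnoCoord L := fun s =>
    (((((![x₀, 0, 0] : Fin 3 → ℝ), (![y₀, 0, 0] : Fin 3 → ℝ)), ((0 : Fin 3 → ℝ), (0 : Fol L → Fin 3 → ℝ))) : GnoCoord L) +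
      s • ((((![0, w.1.1 0, w.1.1 1] : Fin 3 → ℝ), (![0, w.1.2 0, w.1.2 1] : Fin 3 → ℝ)), (w.2.1, w.2.2)) : GnoCoord L)) with hη
  set xh : ℝ → ℍ := fun s => su2Quat (quatToSU2 (gnoLetter ε.1.1 ((![x₀, 0, 0] : Fin 3 → ℝ) + s • ![0, w.1.1 0, w.1.1 1]))) with hxh
  set zh : ℝ → ℍ := fun s => su2Quat (quatToSU2 (gnoLetter true (s • w.2.1))) with hzh
  set yh : ℝ → ℍ := fun s => su2Quat (quatToSU2 (gnoLetter ε.1.2 ((![y₀, 0, 0] : Fin 3 → ℝ) + s • ![0, w.1.2 0, w.1.2 1]))) with hyh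
  set wh : ℝ → ℍ := fun s => star A * xh s * A * zh s with hwh
  set f : ℝ → ℍ := fun s => wh s * yh s - yh s * wh s with hf
  set φ : ℝ → ℝ := fun s => gnoDeficit (fun _ => false) (fun _ => 1) a ε (η s) with hφ
  have hA1 : ‖A‖ = 1 := norm_axisUnit ha
  -- the letters of the ray point
  have hlet : ∀ s, (η s).1.1 = (![x₀, 0, 0] : Fin 3 → ℝ) + s • ![0, w.1.1 0, w.1.1 1] ∧ (η s).2.1 = s • w.2.1 ∧
      (η s).1.2 = (![y₀, 0, 0] : Fin 3 → ℝ) + s • ![0, w.1.2 0, w.1.2 1] := fun s => by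
    obtain ⟨e1, e2, e3, -⟩ := fibrePoint_ray_letters (L := L) x₀ y₀ s w
    exact ⟨e1, e3, e2⟩
  have hxh_rad : ∀ s, xh s = radialUnit (gnoLetter ε.1.1 ((![x₀, 0, 0] : Fin 3 → ℝ) + s • ![0, w.1.1 0, w.1.1 1])) := fun s =>
    su2Quat_quatToSU2_eq_radialUnit (gnoLetter_ne_zero _ _)
  have hzh_rad : ∀ s, zh s = radialUnit (gnoLetter true (s • w.2.1)) := fun s => su2Quat_quatToSU2_eq_radialUnit (gnoLetter_ne_zero _ _)
  have hyh_rad : ∀ s, yh s = radialUnit (gnoLetter ε.1.2 ((![y₀, 0, 0] : Fin 3 → ℝ) + s • ![0, w.1.2 0, w.1.2 1])) := fun s =>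
    su2Quat_quatToSU2_eq_radialUnit (gnoLetter_ne_zero _ _)
  -- leaders `C₀`, `C₁` along the ray read through `su2Quat`
  have hC0 : ∀ s, su2Quat ((blowUpPoint (L := L) 1 (gnomonicPoint a ε (η s))).1 0) = xh s := fun s => by
    rw [su2Quat_gnoLeader_zero, (hlet s).1, hxh_rad]
  have hC1 : ∀ s, su2Quat ((blowUpPoint (L := L) 1 (gnomonicPoint a ε (η s))).1 1) = wh s := fun s => by
    rw [su2Quat_gnoLeader_one ha, (hlet s).1, (hlet s).2.1, hz]
    show _ = star A * xh s * A * zh s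
    rw [hxh_rad, hzh_rad]
  have hC2 : ∀ s, su2Quat ((blowUpPoint (L := L) 1 (gnomonicPoint a ε (η s))).1 2) = yh s := fun s => by
    rw [su2Quat_gnoLeader_two, (hlet s).2.2, hyh_rad]
  -- the minorant `γ(s) = ‖f s‖²/(1800 L⁶) ≤ φ s`
  have hγle : ∀ s, ‖f s‖ ^ 2 / (1800 * (L : ℝ) ^ 6) ≤ φ s := by
    intro s
    set q := blowUpPoint (L := L) 1 (gnomonicPoint a ε (η s)) with hq
    have h := chartDeficit_ge_of_comm_far (L := L) q 1 2 (frobNorm_nonneg _) le_rfl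
    have e1 : (Fin.castSucc (1 : Fin 3) : Fin 4) = 1 := rfl
    have e2 : (Fin.castSucc (2 : Fin 3) : Fin 4) = 2 := rfl
    rw [e1, e2] at h
    have hfd : frobNorm (((q.1 1 * q.1 2 : SU2) : Matrix (Fin 2) (Fin 2) ℂ) - ((q.1 2 * q.1 1 : SU2) : Matrix (Fin 2) (Fin 2) ℂ)) = fd (q.1 1 * q.1 2) (q.1 2 * q.1 1) := by
      simp only [fd]
    have hsq : frobNorm (((q.1 1 * q.1 2 : SU2) : Matrix (Fin 2) (Fin 2) ℂ) - ((q.1 2 * q.1 1 : SU2) : Matrix (Fin 2) (Fin 2) ℂ)) ^ 2 = 2 * ‖f s‖ ^ 2 := by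
      rw [hfd, fd_sq_eq_two_mul, Balaban1983to89.T4HaarSU2Translate.su2Quat_mul, Balaban1983to89.T4HaarSU2Translate.su2Quat_mul, hq, hC1, hC2]
    rw [hsq] at h
    show ‖f s‖ ^ 2 / (1800 * (L : ℝ) ^ 6) ≤ gnoDeficit (fun _ => false) (fun _ => 1) a ε (η s)
    unfold gnoDeficit
    calc ‖f s‖ ^ 2 / (1800 * (L : ℝ) ^ 6) = 2 * ‖f s‖ ^ 2 / (3600 * (L : ℝ) ^ 6) := by field_simp; ring
      _ ≤ _ := h
  -- smoothness
  have hxhd : ContDiff ℝ ∞ xh :=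
    (contDiff_radialUnit_gnoLetter (n := ⊤) ε.1.1).comp (contDiff_const.add (contDiff_id.smul contDiff_const))
  have hzhd : ContDiff ℝ ∞ zh := (contDiff_radialUnit_gnoLetter (n := ⊤) true).comp (contDiff_id.smul contDiff_const)
  have hyhd : ContDiff ℝ ∞ yh :=
    (contDiff_radialUnit_gnoLetter (n := ⊤) ε.1.2).comp (contDiff_const.add (contDiff_id.smul contDiff_const))
  have hwhd : ContDiff ℝ ∞ wh := ((contDiff_const.mul hxhd).mul contDiff_const).mul hzhd
  have hfd : ContDiff ℝ ∞ f := (hwhd.mul hyhd).sub (hyhd.mul hwhd)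
  have hγd : ContDiff ℝ ∞ (fun s => ‖f s‖ ^ 2 / (1800 * (L : ℝ) ^ 6)) := (hfd.norm_sq ℝ).div_const _
  have hφd : ContDiff ℝ ∞ φ := contDiff_gnoDeficit_ray (L := L) (fun _ => false) (fun _ => 1) ha ε _ _ (n := ⊤)
  -- values at `0`
  have hx0 : xh 0 = radialUnit (gnoLetter ε.1.1 ![x₀, 0, 0]) := by rw [hxh_rad]; simp
  have hz0 : zh 0 = 1 := by rw [hzh_rad, zero_smul, gnoLetter_true_zero, radialUnit_one_quat]
  have hax : (xh 0).imJ = 0 ∧ (xh 0).imK = 0 := by rw [hx0]; exact axial_radialUnit (axial_gnoLetter _ _)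
  have hAx : star A * xh 0 * A = xh 0 := star_mul_mul_eq_of_axial hA1 (axisUnit_axial a) hax
  have hw0 : wh 0 = xh 0 := by simp only [hwh, hz0, mul_one, hAx]
  have hy0 : yh 0 = radialUnit (gnoLetter ε.1.2 ![y₀, 0, 0]) := by rw [hyh_rad]; simp
  have hay : (yh 0).imJ = 0 ∧ (yh 0).imK = 0 := by rw [hy0]; exact axial_radialUnit (axial_gnoLetter _ _)
  have hf0 : f 0 = 0 := by
    simp only [hf, hw0]
    rw [axial_comm hax.1 hax.2 hay.1 hay.2, sub_self]
  have hφ0 : φ 0 = 0 := by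
    simp only [hφ, hη, zero_smul, add_zero]
    exact gnoDeficit_base_eq_zero ha ε hz hε x₀ y₀
  -- speeds at `0`
  have hxs : HasDerivAt xh X' 0 := by
    have h := hasDerivAt_xhat_ray ε.1.1 x₀ (w.1.1 0) (w.1.1 1)
    have e : xh = fun s => radialUnit (gnoLetter ε.1.1 ((![x₀, 0, 0] : Fin 3 → ℝ) + s • ![0, w.1.1 0, w.1.1 1])) := funext hxh_rad
    rw [e]; exact h
  have hzs : HasDerivAt zh Z' 0 := by
    have h := hasDerivAt_zhat_ray (w.2.1)
    have e : zh = fun s => radialUnit (gnoLetter true (s • w.2.1)) := funext hzh_rad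
    rw [e]; exact h
  have hys : HasDerivAt yh Y' 0 := by
    have h := hasDerivAt_xhat_ray ε.1.2 y₀ (w.1.2 0) (w.1.2 1)
    have e : yh = fun s => radialUnit (gnoLetter ε.1.2 ((![y₀, 0, 0] : Fin 3 → ℝ) + s • ![0, w.1.2 0, w.1.2 1])) := funext hyh_rad
    rw [e]; exact h
  have hws : HasDerivAt wh (star A * X' * A + xh 0 * Z') 0 := hasDerivAt_slaved_ray hxs hzs hz0 hAx
  have hfs : HasDerivAt f ((star A * X' * A + xh 0 * Z') * yh 0 + wh 0 * Y' - (Y' * wh 0 + yh 0 * (star A * X' * A + xh 0 * Z'))) 0 :=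
    (hws.mul hys).sub (hys.mul hws)
  have hderiv : deriv f 0 = (star A * X' * A + xh 0 * Z') * yh 0 + xh 0 * Y' - Y' * xh 0 - yh 0 * (star A * X' * A + xh 0 * Z') := by
    rw [hfs.deriv, hw0]; noncomm_ring
  -- second derivative of the minorant
  have hγ2 : iteratedDeriv 2 (fun s => ‖f s‖ ^ 2 / (1800 * (L : ℝ) ^ 6)) 0 = 2 * ‖deriv f 0‖ ^ 2 / (1800 * (L : ℝ) ^ 6) := by
    have e : (fun s => ‖f s‖ ^ 2 / (1800 * (L : ℝ) ^ 6)) = fun s => (1800 * (L : ℝ) ^ 6)⁻¹ * ‖f s‖ ^ 2 := by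
      funext s; rw [div_eq_inv_mul]
    rw [e, iteratedDeriv_const_mul _ ((hfd.norm_sq ℝ).contDiffAt.of_le (by norm_cast)),
      iteratedDeriv_two_norm_sq_of_zero (hfd.of_le (by norm_cast)) hf0]
    rw [div_eq_inv_mul]
  -- the minorant comparison
  have key := iteratedDeriv_two_ge_of_minorant hφd hγd hγle (by
    show ‖f 0‖ ^ 2 / (1800 * (L : ℝ) ^ 6) = φ 0
    rw [hf0, hφ0, norm_zero]; simp)
  rw [hγ2, hderiv, hx0, hy0] at key
  calc _ = 2 * ‖(star A * X' * A + radialUnit (gnoLetter ε.1.1 ![x₀, 0, 0]) * Z') * radialUnit (gnoLetter ε.1.2 ![y₀, 0, 0]) +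
        radialUnit (gnoLetter ε.1.1 ![x₀, 0, 0]) * Y' - Y' * radialUnit (gnoLetter ε.1.1 ![x₀, 0, 0]) -
        radialUnit (gnoLetter ε.1.2 ![y₀, 0, 0]) * (star A * X' * A + radialUnit (gnoLetter ε.1.1 ![x₀, 0, 0]) * Z')‖ ^ 2 / (1800 * (L : ℝ) ^ 6) := by
        field_simp; ring
    _ ≤ _ := key

end Summit.QuantumFields.YangMills.Theorems.SwapVirialDeficit.BlowUpRing

end
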